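import Mathlib
import HarnessLib
import Summits.NavierStokesRegularity.NavierStokesRegularity.Theorems.UnthreadedDoorAntidynamoWallFlatAndBeltrami
import Summits.NavierStokesRegularity.NavierStokesRegularity.Theorems.UnthreadedDoorAntidynamoWallEvenSectorFarPast

/-!
# Route `UnthreadedDoor` / `ThreadingFlux`, crux `PoloidalLiouville` (stmt-NavierStokesRegularity-1222), antidynamo v2 skeleton (4ebf5683127b),
# WALL `stub_scalarLiouville`: THE CALORIC MECHANISM NEEDS ITS STRUCTURE ONLY ON A FAR PAST

Support file (seat leafhand-ns-unthreadeddoor-2 g1, cell decomp-ns), `--supports stmt-NavierStokesRegularity-1222 --as helper`; theorems only.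

The wall now has two closing mechanisms: (Z) a flat direction — needed only at times ACCUMULATING at one negative instant (p816144); and (C) a vorticity
that is CALORIC IN SOME GALILEAN FRAME — anti-twins (p816874), anti-periodic / anti-screw patterns (p816926), generalized Beltrami flows (p816997), which
were stated with the structure at EVERY `t < 0`.  Mechanism (C) rests on the heat Liouville theorem on an ANCIENT slab, so it cannot be localised to an
interval, but a FAR PAST suffices: apply the all-time theorem to the time-shifted flow `s ↦ v(s + t₁)` (`timeShift_class`, p814783) and propagate forward
with `CellFlux.forwardVanishing`.

* ★★ `curl_eq_zero_of_curl_antisymmetric_farPast` — `R`-anti-symmetric vorticity for all `t < t₁` (`t₁ ≤ 0`) ⇒ `curl v ≡ 0` on `(−∞,0) × ℝ³`.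
* ★★ `curl_eq_zero_of_lamb_curlFree_farPast` — generalized Beltrami (`curl((v − b) × ω) ≡ 0`, `b` smooth on `(−∞, t₁)`) for all `t < t₁` ⇒ `curl v ≡ 0`.

HONEST LABEL: wrappers; nothing here proves `stub_scalarLiouville`, `PoloidalLiouville` (1222), or bears on Navier–Stokes regularity; no summit statement is
proved (crux 1222 is INCOMPARABLE with the summit). [folklore] [cite: KochNadirashviliSereginSverak2009, Thm 5.2 (arXiv:0709.3599 pp. 9–10)]
-/

noncomputable section

-- the summit and its single sub-problem share the name (CONVENTIONS §1)
set_option linter.dupNamespace false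

open scoped Topology InnerProductSpace RealInnerProductSpace ContDiff
open Filter Set Function Metric MeasureTheory
open Literature.Analysis.FluidPDE

namespace Summit.NavierStokesRegularity.NavierStokesRegularity.Theorems.PoloidalLiouville.Antidynamo

open Summit.NavierStokesRegularity.NavierStokesRegularity.Theorems.PoloidalLiouville
  (constantOfIrrotational)

/-- Glue: irrotational strictly before `t₁` ⇒ irrotational on `(−∞,0)` (`CellFlux.forwardVanishing` from `min t₁ t − 1`, here from `t₁ − 1 < t`). [folklore] -/
theorem curl_eq_zero_of_curl_eq_zero_before
    (v : ℝ → EuclideanSpace ℝ (Fin 3) → EuclideanSpace ℝ (Fin 3))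
    (hB : Literature.Analysis.FluidPDE.IsBoundedAncientMildSolution 1 v)
    (hm : ∀ t < 0, AEStronglyMeasurable (v t) volume)
    (hsm : ContDiffOn ℝ (⊤ : ℕ∞) (Function.uncurry v) (Set.Iio 0 ×ˢ Set.univ))
    {t₁ : ℝ} (hlt : ∀ t < t₁, ∀ x, curl (v t) x = 0) :
    ∀ t < 0, ∀ x, curl (v t) x = 0 := by
  intro t ht x
  by_cases htt : t < t₁
  · exact hlt t htt x
  · have htt' : t₁ ≤ t := not_lt.mp htt
    exact CellFlux.forwardVanishing v hB hm hsm (t₁ - 1) (by linarith) (hlt (t₁ - 1) (by linarith)) t (by linarith) ht x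

/-- ★★ **ANTI-SYMMETRIC VORTICITY ON A FAR PAST ⇒ IRROTATIONAL.**  Let `v` be a bounded ancient mild solution (`ν = 1`, duality class) with measurable
slices, jointly smooth on `(−∞,0) × ℝ³` and unthreaded about `x₀`; `R` a linear isometry, `t₁ ≤ 0`.  If `curl v(t)(x₀ + R y) = −(det R • R (curl v(t)(x₀ + y)))`
for all `t < t₁`, `y`, then `curl v ≡ 0` on `(−∞,0) × ℝ³`. [cite: KochNadirashviliSereginSverak2009, Thm 5.2 (arXiv:0709.3599 pp. 9–10)] -/
theorem curl_eq_zero_of_curl_antisymmetric_farPast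
    (v : ℝ → EuclideanSpace ℝ (Fin 3) → EuclideanSpace ℝ (Fin 3)) (x₀ : EuclideanSpace ℝ (Fin 3))
    (hB : Literature.Analysis.FluidPDE.IsBoundedAncientMildSolution 1 v)
    (hm : ∀ t < 0, AEStronglyMeasurable (v t) volume)
    (hsm : ContDiffOn ℝ (⊤ : ℕ∞) (Function.uncurry v) (Set.Iio 0 ×ˢ Set.univ))
    (hun : ∀ t < 0, ∀ x, ⟪x - x₀, curl (v t) x⟫ = 0)
    (R : EuclideanSpace ℝ (Fin 3) ≃ₗᵢ[ℝ] EuclideanSpace ℝ (Fin 3)) {t₁ : ℝ} (ht₁ : t₁ ≤ 0)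
    (hanti : ∀ t < t₁, ∀ y, curl (v t) (x₀ + R y) =
      -((R : EuclideanSpace ℝ (Fin 3) →L[ℝ] EuclideanSpace ℝ (Fin 3)).det • R (curl (v t) (x₀ + y)))) :
    ∀ t < 0, ∀ x, curl (v t) x = 0 := by
  obtain ⟨hBw, hmw, hsmw⟩ := timeShift_class hB hm hsm ht₁
  have hunw : ∀ s < 0, ∀ x, ⟪x - x₀, curl ((fun s y => v (s + t₁) y) s) x⟫ = 0 :=
    fun s hs x => hun (s + t₁) (by linarith) x
  have hantiw : ∀ s < 0, ∀ y, curl ((fun s y => v (s + t₁) y) s) (x₀ + R y) =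
      -((R : EuclideanSpace ℝ (Fin 3) →L[ℝ] EuclideanSpace ℝ (Fin 3)).det • R (curl ((fun s y => v (s + t₁) y) s) (x₀ + y))) :=
    fun s hs y => hanti (s + t₁) (by linarith) y
  have hw0 := curl_eq_zero_of_curl_antisymmetric (fun s y => v (s + t₁) y) x₀ hBw hmw hsmw hunw R hantiw
  refine curl_eq_zero_of_curl_eq_zero_before v hB hm hsm (t₁ := t₁) fun t ht x => ?_
  have h := hw0 (t - t₁) (by linarith) x
  simp only [sub_add_cancel] at h
  exact h

/-- ★★ **GENERALIZED BELTRAMI ON A FAR PAST ⇒ IRROTATIONAL.**  Same standing hypotheses; if for some `t₁ ≤ 0` and a drift `b` smooth on `(−∞, t₁)` the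
Lamb vector of `v − b` is curl-free at every `t < t₁`, `curl ((v(t) − b(t)) × curl v(t)) ≡ 0`, then `curl v ≡ 0` on `(−∞,0) × ℝ³`.
[cite: KochNadirashviliSereginSverak2009, Thm 5.2 (arXiv:0709.3599 pp. 9–10)] -/
theorem curl_eq_zero_of_lamb_curlFree_farPast
    (v : ℝ → EuclideanSpace ℝ (Fin 3) → EuclideanSpace ℝ (Fin 3)) (x₀ : EuclideanSpace ℝ (Fin 3))
    (hB : Literature.Analysis.FluidPDE.IsBoundedAncientMildSolution 1 v)
    (hm : ∀ t < 0, AEStronglyMeasurable (v t) volume)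
    (hsm : ContDiffOn ℝ (⊤ : ℕ∞) (Function.uncurry v) (Set.Iio 0 ×ˢ Set.univ))
    (hun : ∀ t < 0, ∀ x, ⟪x - x₀, curl (v t) x⟫ = 0)
    {t₁ : ℝ} (ht₁ : t₁ ≤ 0) (b : ℝ → EuclideanSpace ℝ (Fin 3)) (hb : ContDiffOn ℝ ∞ b (Iio t₁))
    (hlamb : ∀ t < t₁, ∀ x, curl (fun y => cross (v t y - b t) (curl (v t) y)) x = 0) :
    ∀ t < 0, ∀ x, curl (v t) x = 0 := by
  obtain ⟨hBw, hmw, hsmw⟩ := timeShift_class hB hm hsm ht₁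
  have hunw : ∀ s < 0, ∀ x, ⟪x - x₀, curl ((fun s y => v (s + t₁) y) s) x⟫ = 0 :=
    fun s hs x => hun (s + t₁) (by linarith) x
  -- the shifted drift is smooth on `(−∞,0)`
  have hbw : ContDiffOn ℝ ∞ (fun s => b (s + t₁)) (Iio 0) :=
    hb.comp (contDiff_id.add contDiff_const).contDiffOn fun s hs => by
      show s + t₁ < t₁
      have : s < 0 := hs
      linarith
  have hlambw : ∀ s < 0, ∀ x,
      curl (fun y => cross ((fun s y => v (s + t₁) y) s y - (fun s => b (s + t₁)) s) (curl ((fun s y => v (s + t₁) y) s) y)) x = 0 :=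
    fun s hs x => hlamb (s + t₁) (by linarith) x
  have hw0 := curl_eq_zero_of_lamb_curlFree (fun s y => v (s + t₁) y) x₀ hBw hmw hsmw hunw (fun s => b (s + t₁)) hbw hlambw
  refine curl_eq_zero_of_curl_eq_zero_before v hB hm hsm (t₁ := t₁) fun t ht x => ?_
  have h := hw0 (t - t₁) (by linarith) x
  simp only [sub_add_cancel] at h
  exact h

/-- ★★ **… HENCE SLICE-WISE CONSTANT** (both far-past forms). [cite: KochNadirashviliSereginSverak2009, Thm 5.2 (arXiv:0709.3599 pp. 9–10)] -/
theorem constant_of_curl_antisymmetric_farPast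
    (v : ℝ → EuclideanSpace ℝ (Fin 3) → EuclideanSpace ℝ (Fin 3)) (x₀ : EuclideanSpace ℝ (Fin 3))
    (hB : Literature.Analysis.FluidPDE.IsBoundedAncientMildSolution 1 v)
    (hm : ∀ t < 0, AEStronglyMeasurable (v t) volume)
    (hsm : ContDiffOn ℝ (⊤ : ℕ∞) (Function.uncurry v) (Set.Iio 0 ×ˢ Set.univ))
    (hun : ∀ t < 0, ∀ x, ⟪x - x₀, curl (v t) x⟫ = 0)
    (R : EuclideanSpace ℝ (Fin 3) ≃ₗᵢ[ℝ] EuclideanSpace ℝ (Fin 3)) {t₁ : ℝ} (ht₁ : t₁ ≤ 0)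
    (hanti : ∀ t < t₁, ∀ y, curl (v t) (x₀ + R y) =
      -((R : EuclideanSpace ℝ (Fin 3) →L[ℝ] EuclideanSpace ℝ (Fin 3)).det • R (curl (v t) (x₀ + y)))) :
    ∀ t < 0, ∃ c : EuclideanSpace ℝ (Fin 3), ∀ x, v t x = c :=
  constantOfIrrotational v hB hsm (curl_eq_zero_of_curl_antisymmetric_farPast v x₀ hB hm hsm hun R ht₁ hanti)

end Summit.NavierStokesRegularity.NavierStokesRegularity.Theorems.PoloidalLiouville.Antidynamo

end
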